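import Literature.AlgebraicGeometry.Morphisms.ProjectiveEmbeddingPositiveDimension
import Literature.AlgebraicGeometry.Motives.HilbertSchemeOverBaseLetters
import Literature.AlgebraicGeometry.Morphisms.HomSchemeClosedLayer
import Literature.AlgebraicGeometry.Morphisms.IsoLocusOfFlatProper
import Literature.AlgebraicGeometry.Morphisms.HomSchemePieceOfLayers
import Literature.AlgebraicGeometry.Morphisms.GraphFamilyHilbertPolynomial
import Literature.AlgebraicGeometry.Morphisms.HomSchemeGluing
import HarnessLib

/-!
# The Hom-scheme `Hom_S(Y, X)` of projective `S`-schemes ([MumfordFogartyKirwan1994] Ch. 0 §5 (c); [FGA] no. 221 §4.c)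

Layer `Literature/AlgebraicGeometry/Morphisms`, namespace `Literature.AlgebraicGeometry.Morphisms`.  THEOREMS ONLY: no definition, no instance,
no notation, no named fact, no `sorry`.  Universe `0` (that of the Hilbert scheme ★ `Motives/HilbertImageInGrassmannianUniversalFamily`).

**`exists_homScheme_of_projective`** — for `S` locally Noetherian, `q : Y → S` FLAT projective and `p : X → S` projective, the functor
`T ↦ Hom_T(Y_T, X_T)` on locally Noetherian `S`-schemes is REPRESENTED: there are an `S`-scheme `m : M → S` with `M` locally Noetherian, `m`
separated and locally of finite type, and a universal `M`-morphism `u : Y_M → X_M`, such that every `T`-morphism `φ : Y_T → X_T` (`T` locally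
Noetherian over `S` via `v`) is the base change of `u` along a UNIQUE `w : T → M` over `S` (comparison maps `pullback.map` along `w`).  The TYPE is
the cell's II-b letter v2 (B-p17 (g15) 6c82be24) VERBATIM = the tree decls `Summit.….F4LinearRigidificationII.stub_IIb_homScheme` (parent line
`Cruxes/HDel/Lines/F4LinearRigidificationII.lean` ED. 2.1) and `….IIbHomScheme.stub_IIb_homScheme_holds` (child line `Cruxes/HDel/Lines/F4IIbHomScheme.lean`
ED. 3), so that both fold BY THIS LIBRARY NAME (lead ruling J-P1a-10, 22:49:25Z; `Cruxes/…/Lines` modules are never imported).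

THE PROOF is the child line's composition re-homed over the ★ closers, by import only (MFK Ch. 0 §5 (c): «`Hom_S(X, Y)` is an open subscheme of
a closed subscheme of `Hilb_{X ×_S Y / S}`», cut piece by piece over the Hilbert polynomials of graphs):
(A) a closed `S`-embedding `jW : Y ×_S X ↪ 𝐏(ι; S)` with `1 ≤ #ι` (★ `IsProjective.exists_isClosedImmersion_pullback_one_le_card`, F0P1a-p04 (g0));
(B) for every ADMISSIBLE polynomial `Q` the PIECE `M_Q` with its universal morphism `u_Q` (★ `exists_homSchemePiece_of_layers`, F0P1a-p02 (g0))
assembled from the three layers (B1) the Hilbert scheme of `Q` over `S` in field-point letters (★ `Motives.exists_hilbertScheme_over_letters`,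
B-p14 (g20)), (B2) the closed condition «the family lies in `W = Y ×_S X`» (★ `exists_idealSheafData_homSchemeClosedLayer`, B-p20 (g15)), (B3) the
open condition «the family projects isomorphically onto `Y`» ([GortzWedhorn2020] Prop. 14.28; ★ `exists_opens_isIso_morphismRestrict_forall_mem_iff`
+ `isIso_pullbackMap_iff_range_subset`, B-p09 (g17), the 3-line closer of F0P1a-p04 (g0) — here the private `openLayer_of_isoLocus`);
(C) the graph family of any `T`-morphism has a locally constant, admissible Hilbert polynomial (★ `graphFamily_hilbertPolynomial_decomposition`,
B-p14 (g20)); (D) gluing `M := ∐_Q M_Q` over the clopen decomposition (★ `exists_homScheme_of_pieces`, F0P1a-p01 (g0)).  The composition is the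
child head's (B-p14 (g20) skeleton v0.2∕v0.4), kernel-certified end to end in `F0/P1a/CERT-F4IIbHomScheme.ALL-IN.F0P1ap03g0.lean` fa56ee03.

Cell `hodgecm-mathlib`, FLOOR 0 sub-programme P1a, filing F22 (PLAN v2 8302fb22 §2), F0P1a-p03 (g0).  Count-neutral Mathlib-side capital: HC_CM is
proved only modulo the 7 printed citations until rung 0 closes; nothing here bears on it.

## References
* D. Mumford, J. Fogarty, F. Kirwan, *Geometric Invariant Theory*, 3rd ed. (1994), Ch. 0 §5 (c) (p. 23). [MumfordFogartyKirwan1994]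
* A. Grothendieck, *Fondements de la géométrie algébrique*, Sém. Bourbaki no. 221 (1960∕61), §4.c. [FGA]
* U. Görtz, T. Wedhorn, *Algebraic Geometry I*, 2nd ed. (2020), Proposition 14.28 (p. 438). [GortzWedhorn2020]
* N. Nitsure, *Construction of Hilbert and Quot schemes*, in *FGA Explained* (2005), Theorem 5.23 (the Hom-scheme). [Nitsure2005]
-/

noncomputable section

set_option backward.isDefEq.respectTransparency false

open CategoryTheory CategoryTheory.Limits CategoryTheory.Abelian AlgebraicGeometry Polynomial
open Literature.AlgebraicGeometry
open Literature.AlgebraicGeometry.Modules Literature.AlgebraicGeometry.Modules.SerreTwist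
open Literature.Algebra.Homology Literature.Algebra.Homology.LaurentCech Literature.Algebra.Homology.OrderedCech

namespace Literature.AlgebraicGeometry.Morphisms

/-- **(B3) The open layer «the family projects isomorphically onto `Y`»** in the shape the piece assembly consumes (= the child line's
`stub_IIb4B3_openLayer` VERBATIM): for `f : Γ → V` proper flat, `q′ : Y′ → V` separated universally closed with `Y′` locally Noetherian and
`g : Γ → Y′` over `V`, an OPEN `U ⊆ V` such that `b : T → V` lands in `U` iff the base change `g_T` is an isomorphism — B-p09 (g17)'s ★
`Morphisms/IsoLocusOfFlatProper` (`exists_opens_isIso_morphismRestrict_forall_mem_iff`, `isIso_pullbackMap_iff_range_subset`), F0P1a-p04 (g0)'s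
3-line closer. [cite: GortzWedhorn2020, Proposition 14.28 (p. 438)] -/
private theorem openLayer_of_isoLocus : ∀ ⦃V Γ Y' : Scheme.{0}⦄ (f : Γ ⟶ V) (q' : Y' ⟶ V) (g : Γ ⟶ Y') (hg : g ≫ q' = f)
    [IsProper f] [Flat f] [IsSeparated q'] [UniversallyClosed q'] [IsLocallyNoetherian Y'],
    ∃ U : V.Opens, ∀ ⦃T : Scheme.{0}⦄ (b : T ⟶ V),
      IsIso (pullback.map f b q' b g (𝟙 T) (𝟙 V) (by rw [Category.comp_id, hg]) (by rw [Category.comp_id, Category.id_comp])) ↔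
        Set.range b.base ⊆ (U : Set V) := by
  intro V Γ Y' f q' g hg _ _ _ _ _
  obtain ⟨U, hU, hUiff⟩ := exists_opens_isIso_morphismRestrict_forall_mem_iff f q' g hg
  exact ⟨U, fun T b => isIso_pullbackMap_iff_range_subset f q' g hg U hU hUiff b⟩

/-- **THE HOM-SCHEME OF PROJECTIVE `S`-SCHEMES** ([MumfordFogartyKirwan1994] Ch. 0 §5 (c); [FGA] 221 §4.c): for `q : Y → S` flat projective and
`p : X → S` projective over a locally Noetherian `S`, the functor of `T`-morphisms `Y_T → X_T` (`T` locally Noetherian over `S`) is represented by an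
`S`-scheme `m : M → S` (`M` locally Noetherian; `m` separated, locally of finite type) with universal morphism `u : Y_M → X_M`.  TYPE = the cell's
II-b letter v2 VERBATIM (tree `…F4LinearRigidificationII.stub_IIb_homScheme` ≡ `…IIbHomScheme.stub_IIb_homScheme_holds`); PROOF = (A) ▸ (B) for every
admissible `Q` (by choice, from the layers (B1)(B2)(B3)) ▸ (D) fed with (C) — all ★ by import (see the module docstring for the closers and hands).
[cite: MumfordFogartyKirwan1994, Ch. 0 §5 (c) (p. 23)] [cite: Nitsure2005, Theorem 5.23] -/
theorem exists_homScheme_of_projective : ∀ ⦃S Y X : Scheme.{0}⦄ [IsLocallyNoetherian S] (q : Y ⟶ S) (p : X ⟶ S) [Flat q]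
    (_ : IsProjective q) (_ : IsProjective p),
    ∃ (M : Scheme.{0}) (m : M ⟶ S) (_ : IsLocallyNoetherian M) (_ : IsSeparated m) (_ : LocallyOfFiniteType m)
      (u : pullback q m ⟶ pullback p m) (_ : u ≫ pullback.snd p m = pullback.snd q m),
      ∀ ⦃T : Scheme.{0}⦄ [IsLocallyNoetherian T] (v : T ⟶ S) (φ : pullback q v ⟶ pullback p v)
        (hφ : φ ≫ pullback.snd p v = pullback.snd q v),
        ∃! w : T ⟶ M, ∃ (hw : w ≫ m = v),
          φ ≫ pullback.map p v p m (𝟙 X) w (𝟙 S) (by simp) (by simpa using hw.symm) =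
            pullback.map q v q m (𝟙 Y) w (𝟙 S) (by simp) (by simpa using hw.symm) ≫ u := by
  intro S Y X _ q p _ hq hp
  -- (A) the product embedding `Y ×_S X ↪ 𝐏(ι; S)` with `1 ≤ #ι`
  obtain ⟨ι, _, hn, jW, hjW, hjWfst⟩ := hq.exists_isClosedImmersion_pullback_one_le_card hp
  haveI := hjW
  -- (B) the pieces, one for every admissible polynomial (choice), from the three layers (B1)(B2)(B3)
  have hB := fun Q : {Q : ℚ[X] // ∀ e : ℕ, regularityBound (preHilbertPoly ℚ (Nat.card ι) 0) 0
      (preHilbertPoly ℚ (Nat.card ι) 0 - Q) - 1 ≤ (e : ℤ) → ((⌊Q.eval (e : ℚ)⌋₊ : ℕ) : ℚ) = Q.eval (e : ℚ)} =>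
    exists_homSchemePiece_of_layers Motives.exists_hilbertScheme_over_letters exists_idealSheafData_homSchemeClosedLayer
      openLayer_of_isoLocus q p hq hp hn jW hjWfst Q.1 Q.2
  choose M_ m_ hMn hMs hMl u_ hu_ hB' using hB
  -- (D) gluing over the clopen decomposition (C)
  exact exists_homScheme_of_pieces q p hq hp hn jW hjWfst M_ m_ hMn hMs hMl u_ hu_ hB'
    (fun T _ v φ hφ hw iΓ h₁ h₂ => graphFamily_hilbertPolynomial_decomposition q p hn jW hjWfst v φ hφ hw iΓ h₁ h₂)

end Literature.AlgebraicGeometry.Morphisms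

end
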